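import Summits.BirchSwinnertonDyer.BirchSwinnertonDyer.Theorems.ManinLocalTwoThreeKummerSquareCriterion
import Mathlib.RingTheory.PowerSeries.Catalan
import HarnessLib

/-!
# Kummer-blindness criterion, part 3: the converse square root — `2 ∣ ε`, `16 ∣ ε² − 4γ` make `P² + εt²P + γt⁴` a square

Summit `BirchSwinnertonDyer`, route `ManinLocalTwoThree` (cell bsd-f2-manin), crux C2 `ManinOddAtFour` (stmt-BirchSwinnertonDyer-22967),
line `kato_shift_two`, v10 stubs `stub_cuspidalKummerOddExponent` (E-an-53) / `stub_blindOrbitMinimalResidual`.  Converse of part 1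
(`two_dvd_and_sixteen_dvd_of_isSquare`): for `P ∈ ℤ₂⟦t⟧` with `P(0) = 1` and `ε = 2α`, `ε² − 4γ = 16k`, the series
`Q = P² + εt²P + γt⁴ = (P + αt²)² − 4k t⁴` IS a square in `ℤ₂⟦t⟧`: `Q = (U(1 + 2v))²` with `U = P + αt²` (a unit),
`u = −k t⁴/U²` and `v = u·c(−u)`, where `c = Σ Catₙ xⁿ` is the Catalan series (Mathlib `PowerSeries.catalanSeries`,
`c = 1 + x c²`), so that `v + v² = u` and `(1 + 2v)² = 1 + 4u`.  Used by the lead's «blind ⟹ the certificate is silent»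
theorem (file `…CuspidalKummerBlindSilent`).  Nothing about BSD or Manin's conjecture is proved here. [folklore algebra]
-/

set_option autoImplicit false
set_option linter.dupNamespace false

noncomputable section

open scoped Classical
open PowerSeries

namespace Summit.BirchSwinnertonDyer.BirchSwinnertonDyer.Theorems.ManinLocalTwoThree

section CatalanSqrt

variable {R : Type*} [CommRing R]

/-- The Catalan series over `R`: `c = 1 + x·c²` (Mathlib `catalanSeries_sq_mul_X_add_one`, mapped). [folklore] -/
private theorem catalan_map_eq (R : Type*) [CommRing R] :
    (PowerSeries.map (Nat.castRingHom R) catalanSeries) =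
      1 + X * (PowerSeries.map (Nat.castRingHom R) catalanSeries) ^ 2 := by
  have h := congrArg (PowerSeries.map (Nat.castRingHom R)) catalanSeries_sq_mul_X_add_one
  rw [map_add, map_mul, map_pow, map_X, map_one] at h
  linear_combination (-1 : R⟦X⟧) * h

/-- **`1 + 4u` is a square for `u ∈ tR⟦t⟧`**: with `v = u·c(−u)` (`c` the Catalan series) one has `v + v² = u`, hence
`(1 + 2v)² = 1 + 4u`. [folklore] -/
theorem exists_sq_eq_one_add_four_mul {u : R⟦X⟧} (hu : constantCoeff u = 0) :
    ∃ v : R⟦X⟧, constantCoeff v = 0 ∧ (1 + 2 * v) ^ 2 = 1 + 4 * u := by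
  set c : R⟦X⟧ := PowerSeries.map (Nat.castRingHom R) catalanSeries with hc
  have hsu : HasSubst (-u) := HasSubst.of_constantCoeff_zero' (by rw [map_neg, hu, neg_zero])
  -- `c(−u) = 1 − u·c(−u)²`
  have hcu : c.subst (-u) = 1 - u * (c.subst (-u)) ^ 2 := by
    have h := congrArg (PowerSeries.subst (-u)) (catalan_map_eq R)
    rw [← hc] at h
    rw [subst_add hsu, subst_mul hsu, subst_pow hsu, subst_X hsu, show (1 : R⟦X⟧) = C (1 : R) from (map_one C).symm,
      Literature.NumberTheory.EllipticCurves.C_subst, map_one] at h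
    linear_combination h
  refine ⟨u * c.subst (-u), by rw [map_mul, hu, zero_mul], ?_⟩
  have hv : u * c.subst (-u) + (u * c.subst (-u)) ^ 2 = u := by linear_combination u * hcu
  linear_combination (4 : R⟦X⟧) * hv

end CatalanSqrt

section TwoAdicConverse

/-- **Converse of the coefficient lemma.**  For `P ∈ ℤ₂⟦t⟧` with `P(0) = 1`, if `2 ∣ ε` and `16 ∣ ε² − 4γ` then
`P² + ε t² P + γ t⁴` is a square in `ℤ₂⟦t⟧`: `= (P + αt²)² + 4βt⁴ = ((P + αt²)(1 + 2v))²` with `ε = 2α`, `4β = γ − α²`,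
`u = βt⁴/(P + αt²)²`, `(1 + 2v)² = 1 + 4u`. [folklore] -/
theorem isSquare_of_two_dvd_of_sixteen_dvd {P : ℤ_[2]⟦X⟧} (h0 : constantCoeff P = 1) {ε γ : ℤ_[2]}
    (h2 : (2 : ℤ_[2]) ∣ ε) (h16 : (16 : ℤ_[2]) ∣ ε ^ 2 - 4 * γ) :
    IsSquare (P ^ 2 + C ε * X ^ 2 * P + C γ * X ^ 4) := by
  obtain ⟨α, hα⟩ := h2
  obtain ⟨k, hk⟩ := h16
  -- `γ = α² − 4k`
  have hγ : γ = α ^ 2 - 4 * k := by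
    have h4 : (4 : ℤ_[2]) * (γ - α ^ 2 + 4 * k) = 0 := by rw [hα] at hk; linear_combination -hk
    rcases mul_eq_zero.mp h4 with h | h
    · exact absurd h (by norm_num)
    · linear_combination h
  set U : ℤ_[2]⟦X⟧ := P + C α * X ^ 2 with hU
  have hU0 : constantCoeff U = 1 := by
    rw [hU, map_add, h0, map_mul, map_pow, constantCoeff_X, zero_pow two_ne_zero, mul_zero, add_zero]
  have hUunit : IsUnit U := by rw [isUnit_iff_constantCoeff, hU0]; exact isUnit_one
  obtain ⟨Ui, hUi⟩ := hUunit.exists_right_inv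
  set u : ℤ_[2]⟦X⟧ := -(C k * X ^ 4 * Ui ^ 2) with hu
  have hu0 : constantCoeff u = 0 := by
    rw [hu, map_neg, map_mul, map_mul, map_pow, constantCoeff_X, zero_pow (by norm_num), mul_zero, zero_mul,
      neg_zero]
  obtain ⟨v, -, hv⟩ := exists_sq_eq_one_add_four_mul hu0
  refine ⟨U * (1 + 2 * v), ?_⟩
  have hQ : P ^ 2 + C ε * X ^ 2 * P + C γ * X ^ 4 = U ^ 2 - 4 * C k * X ^ 4 := by
    rw [hU, hα, hγ, map_sub, map_mul, map_pow, map_mul, show (C (2 : ℤ_[2]) : ℤ_[2]⟦X⟧) = 2 from map_ofNat C 2,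
      show (C (4 : ℤ_[2]) : ℤ_[2]⟦X⟧) = 4 from map_ofNat C 4]
    ring
  rw [hQ]
  have hUU : (U * Ui) ^ 2 = 1 := by rw [hUi, one_pow]
  calc U ^ 2 - 4 * C k * X ^ 4 = U ^ 2 * (1 + 4 * u) := by
        rw [hu]; linear_combination (4 * C k * X ^ 4) * hUU
    _ = U * (1 + 2 * v) * (U * (1 + 2 * v)) := by rw [← hv]; ring

end TwoAdicConverse

end Summit.BirchSwinnertonDyer.BirchSwinnertonDyer.Theorems.ManinLocalTwoThree

end
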